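import Summits.Ventures.DiscreteObjects.Hadamard.ConferenceGraph333Order166Orbits
import Summits.Ventures.DiscreteObjects.Hadamard.ConferenceGraph333InvolutionBound

/-!
# The centraliser of an automorphism of order 83 of srg(333,166,82,83) contains at most one involution (kernel)

Framing: lottery ticket; floor = certified bounds/negative ranges.  Cell pub-namedobj (venture DiscreteObjects),
target (H) = `H(668)`, hadamard gen 30.  Local structure at the prime `83` (towards '|N(P₈₃)| divides 332', HANDOFF-H-g30 item 3b):
* `involution_centralizing_order83_fixed_one` — an involution `τ` commuting with `ρ` of order `83` fixes exactly ONE vertex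
  (`σ = ρτ` has order `166` and `σ⁸³ = τ`; `ConferenceGraph333Order166.aut_order166_structure`).
* **`no_two_involutions_centralizing_order83`** — there are no two distinct commuting involutions `τ₁, τ₂` both commuting with
  `ρ`: with `σ = ρτ₁` (order `166`, fixed vertex `∞`, regular orbits `X = N(∞)` and `Y`, `ConferenceGraph333Order166Orbits`),
  `τ₂` commutes with `σ`, fixes `∞`, preserves `X` and acts on it as a power `σ^j` (it commutes with the regular `ℤ/166`);
  `τ₂² = 1` forces `166 ∣ 2j`, so on `X` either `τ₂ = 1` or `τ₂ = σ⁸³ = τ₁`: then `τ₂` or `τ₁τ₂` is an involution fixing the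
  `167` vertices `X ∪ {∞}`, against the involution bound `165` (gen 29).
So the centraliser `C(ρ)` has a Sylow `2`-subgroup of order `≤ 2` (no element of order `4` either: order `332` is excluded,
`ConferenceGraph333LargePrimeProducts`), and — odd primes `q` giving excluded orders `83q` — `|C(ρ)| ∈ {83, 166}`; with
`no_order41_normalizing_order83` the normaliser of a Sylow `83`-subgroup has order dividing `332` (on paper; the group-theoretic
plumbing is not formalised here).  WORDS: structure of a HYPOTHETICAL object; ours (PROVISIONAL).  No `sorry`, no new definitions.
-/

namespace Summit.Ventures.DiscreteObjects.Hadamard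

open Finset

section centralizer83
variable {V : Type*} [Fintype V] [DecidableEq V]

omit [Fintype V] [DecidableEq V] in
/-- `σ = ρτ` has order `166` when `ρ` has order `83`, `τ` is an involution and they commute: `σ^166 = 1`, `σ^83 = τ`, `σ² = ρ²`. -/
theorem order166_of_commuting (ρ τ : Equiv.Perm V) (hρ : ρ ^ 83 = 1) (hτ : τ ^ 2 = 1) (hc : ρ * τ = τ * ρ) :
    (ρ * τ) ^ 166 = 1 ∧ (ρ * τ) ^ 83 = τ ∧ (ρ * τ) ^ 2 = ρ ^ 2 := by
  have hcomm : Commute ρ τ := hc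
  refine ⟨?_, ?_, ?_⟩
  · rw [hcomm.mul_pow, show (166 : ℕ) = 83 * 2 by norm_num, pow_mul, hρ, one_pow, one_mul, pow_mul', hτ, one_pow]
  · rw [hcomm.mul_pow, hρ, one_mul, show (83 : ℕ) = 2 * 41 + 1 by norm_num, pow_succ, pow_mul, hτ, one_pow, one_mul]
  · rw [hcomm.mul_pow, hτ, mul_one]

/-- **An involution commuting with an automorphism of order 83 fixes exactly one vertex.** -/
theorem involution_centralizing_order83_fixed_one (hV : Fintype.card V = 333) (A : Matrix V V ℤ)
    (h01 : ∀ x y, A x y = 0 ∨ A x y = 1) (hsymm : ∀ x y, A y x = A x y) (hdiag : ∀ x, A x x = 0)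
    (hk : ∀ x, ∑ y, A x y = 166) (hsrg : ∀ x y, ∑ z, A x z * A z y = 83 * (1 + (if x = y then 1 else 0)) - A x y)
    (ρ τ : Equiv.Perm V) (hρ : ρ ^ 83 = 1) (hρ1 : ρ ≠ 1) (hτ : τ ^ 2 = 1) (hτ1 : τ ≠ 1) (hc : ρ * τ = τ * ρ)
    (hAρ : ∀ x y, A (ρ x) (ρ y) = A x y) (hAτ : ∀ x y, A (τ x) (τ y) = A x y) :
    (univ.filter fun x => τ x = x).card = 1 := by
  obtain ⟨h166, h83, h2⟩ := order166_of_commuting ρ τ hρ hτ hc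
  have hρ2 : ρ ^ 2 ≠ 1 := fun h => hρ1 (by
    have e : ρ ^ 83 = (ρ ^ 2) ^ 41 * ρ := by rw [← pow_mul, ← pow_succ]
    rw [h, one_pow, one_mul, hρ] at e
    exact e.symm)
  have hAσ : ∀ x y, A ((ρ * τ) x) ((ρ * τ) y) = A x y := fun x y => by
    rw [Equiv.Perm.mul_apply, Equiv.Perm.mul_apply, hAρ, hAτ]
  obtain ⟨-, -, hf83⟩ := aut_order166_structure hV A h01 hsymm hdiag hk hsrg (ρ * τ) h166 (by rw [h83]; exact hτ1)
    (by rw [h2]; exact hρ2) hAσ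
  rw [h83] at hf83
  exact hf83

/-- **No two distinct commuting involutions centralise an automorphism of order 83.** -/
theorem no_two_involutions_centralizing_order83 (hV : Fintype.card V = 333) (A : Matrix V V ℤ)
    (h01 : ∀ x y, A x y = 0 ∨ A x y = 1) (hsymm : ∀ x y, A y x = A x y) (hdiag : ∀ x, A x x = 0)
    (hk : ∀ x, ∑ y, A x y = 166) (hsrg : ∀ x y, ∑ z, A x z * A z y = 83 * (1 + (if x = y then 1 else 0)) - A x y)
    (ρ τ₁ τ₂ : Equiv.Perm V) (hρ : ρ ^ 83 = 1) (hρ1 : ρ ≠ 1) (h1 : τ₁ ^ 2 = 1) (h1ne : τ₁ ≠ 1) (h2 : τ₂ ^ 2 = 1)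
    (h2ne : τ₂ ≠ 1) (hne : τ₁ ≠ τ₂) (hc1 : ρ * τ₁ = τ₁ * ρ) (hc2 : ρ * τ₂ = τ₂ * ρ) (hc12 : τ₁ * τ₂ = τ₂ * τ₁)
    (hAρ : ∀ x y, A (ρ x) (ρ y) = A x y) (hA1 : ∀ x y, A (τ₁ x) (τ₁ y) = A x y) (hA2 : ∀ x y, A (τ₂ x) (τ₂ y) = A x y) :
    False := by
  classical
  obtain ⟨h166, h83, hsq⟩ := order166_of_commuting ρ τ₁ hρ h1 hc1
  set σ := ρ * τ₁ with hσ_def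
  have hρ2 : ρ ^ 2 ≠ 1 := fun h => hρ1 (by
    have e : ρ ^ 83 = (ρ ^ 2) ^ 41 * ρ := by rw [← pow_mul, ← pow_succ]
    rw [h, one_pow, one_mul, hρ] at e
    exact e.symm)
  have hAσ : ∀ x y, A (σ x) (σ y) = A x y := fun x y => by
    rw [hσ_def, Equiv.Perm.mul_apply, Equiv.Perm.mul_apply, hAρ, hA1]
  have hσ83 : σ ^ 83 ≠ 1 := by rw [h83]; exact h1ne
  have hσ2 : σ ^ 2 ≠ 1 := by rw [hsq]; exact hρ2
  obtain ⟨o, hσinf, huniq, horb⟩ := aut_order166_two_orbits hV A h01 hsymm hdiag hk hsrg σ h166 hσ83 hσ2 hAσ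
  -- τ₂ commutes with σ
  have hcσ : σ * τ₂ = τ₂ * σ := by
    rw [hσ_def, mul_assoc, hc12, ← mul_assoc, hc2, mul_assoc]
  have hcσk : ∀ k : ℕ, ∀ x, τ₂ ((σ ^ k) x) = (σ ^ k) (τ₂ x) := by
    intro k x
    have : Commute σ τ₂ := hcσ
    have hk' := (this.pow_left k).eq   -- σ^k * τ₂ = τ₂ * σ^k
    have := congrArg (fun g : Equiv.Perm V => g x) hk'
    simp only [Equiv.Perm.coe_mul, Function.comp_apply] at this
    exact this.symm
  -- τ₂ fixes o
  have hτ2inf : τ₂ o = o := by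
    apply huniq
    have := hcσk 1 o
    rw [pow_one, hσinf] at this
    exact this.symm
  -- a neighbour x₀ of o
  set X := univ.filter (fun z => A o z = 1) with hX
  have hXcard : X.card = 166 := by
    have e := sum01_eq_card_filter (fun z => A o z) (h01 o) univ
    rw [hk o] at e; exact_mod_cast e.symm
  obtain ⟨x₀, hx₀⟩ : X.Nonempty := by rw [← Finset.card_pos, hXcard]; norm_num
  have hAx₀ : A o x₀ = 1 := (Finset.mem_filter.mp hx₀).2
  have hx₀inf : x₀ ≠ o := by rintro rfl; rw [hdiag] at hAx₀; norm_num at hAx₀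
  -- τ₂ x₀ lies on the same side: τ₂ x₀ = σ^j x₀
  have hτ2x₀ : A o (τ₂ x₀) = A o x₀ := by
    conv_lhs => rw [← hτ2inf]
    exact hA2 o x₀
  have hτ2x₀inf : τ₂ x₀ ≠ o := fun h => hx₀inf (τ₂.injective (by rw [h, hτ2inf]))
  obtain ⟨j, hj, hjx⟩ := horb x₀ (τ₂ x₀) hx₀inf hτ2x₀inf hτ2x₀.symm
  -- τ₂ = σ^j on the side of x₀ (all of X)
  have hτ2X : ∀ x ∈ X, τ₂ x = (σ ^ j) x := by
    intro x hx
    have hAx : A o x = 1 := (Finset.mem_filter.mp hx).2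
    have hxinf : x ≠ o := by rintro rfl; rw [hdiag] at hAx; norm_num at hAx
    obtain ⟨k, -, rfl⟩ := horb x₀ x hx₀inf hxinf (by rw [hAx₀, hAx])
    rw [hcσk k x₀, ← hjx, ← Equiv.Perm.mul_apply, ← Equiv.Perm.mul_apply, ← pow_add, ← pow_add, add_comm]
  -- σ^(2j) fixes x₀, hence 166 ∣ 2j
  have h2j : (σ ^ (2 * j)) x₀ = x₀ := by
    have : τ₂ (τ₂ x₀) = x₀ := by
      have := congrArg (fun g : Equiv.Perm V => g x₀) h2
      simpa [pow_two] using this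
    rw [hτ2X x₀ hx₀, hτ2X _ (Finset.mem_filter.mpr ⟨Finset.mem_univ _, by rw [hjx, hτ2x₀, hAx₀]⟩),
      ← Equiv.Perm.mul_apply, ← pow_add, ← two_mul] at this
    exact this
  have hσx₀ : σ x₀ ≠ x₀ := fun h => hx₀inf (huniq x₀ h)
  obtain ⟨o', hσinf', -, huniq2, huniq83⟩ := aut_order166_fixed_unique hV A h01 hsymm hdiag hk hsrg σ h166 hσ83 hσ2 hAσ
  have hinf' : o' = o := huniq o' hσinf'
  rw [hinf'] at huniq2 huniq83
  -- reduce 2j mod 166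
  have hmod : (σ ^ (2 * j % 166)) x₀ = x₀ := by rw [← perm_pow_apply_mod σ h166]; exact h2j
  have hdz : 2 * j % 166 = 0 := by
    by_contra hne0
    rcases perm166_small_period σ h166 (Nat.pos_of_ne_zero hne0) (Nat.mod_lt _ (by norm_num)) hmod with h | h | h
    · exact hσx₀ h
    · exact hx₀inf (huniq2 x₀ h)
    · exact hx₀inf (huniq83 x₀ h)
  -- so j = 0 or j = 83
  have hj' : j = 0 ∨ j = 83 := by omega
  -- in either case some involution ≠ 1 fixes X ∪ {o}: 167 > 165 fixed points
  have hbig : ∀ (τ : Equiv.Perm V), (∀ x, τ (τ x) = x) → τ ≠ 1 → (∀ x y, A (τ x) (τ y) = A x y) → τ o = o →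
      (∀ x ∈ X, τ x = x) → False := by
    intro τ hinv hτne hAτ hτinf hτX
    obtain ⟨-, hle⟩ := involution_window hV A h01 hsymm hdiag hk hsrg τ hinv hτne hAτ
    have hsub : insert o X ⊆ univ.filter (fun x => τ x = x) := by
      intro x hx
      rw [Finset.mem_insert] at hx
      rw [Finset.mem_filter]
      rcases hx with rfl | hx
      · exact ⟨Finset.mem_univ _, hτinf⟩
      · exact ⟨Finset.mem_univ _, hτX x hx⟩
    have hc := Finset.card_le_card hsub
    have hninf : o ∉ X := fun h => by
      have := (Finset.mem_filter.mp h).2; rw [hdiag] at this; norm_num at this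
    rw [Finset.card_insert_of_notMem hninf, hXcard] at hc
    omega
  have hinv2 : ∀ x, τ₂ (τ₂ x) = x := fun x => by
    have := congrArg (fun g : Equiv.Perm V => g x) h2; simpa [pow_two] using this
  rcases hj' with rfl | rfl
  · -- τ₂ = 1 on X
    exact hbig τ₂ hinv2 h2ne hA2 hτ2inf (fun x hx => by rw [hτ2X x hx, pow_zero, Equiv.Perm.one_apply])
  · -- τ₂ = σ^83 = τ₁ on X: τ₁ τ₂ fixes X
    have hτ12 : ∀ x ∈ X, (τ₁ * τ₂) x = x := by
      intro x hx
      rw [Equiv.Perm.mul_apply, hτ2X x hx, h83]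
      have := congrArg (fun g : Equiv.Perm V => g x) h1; simpa [pow_two] using this
    have hinv12 : ∀ x, (τ₁ * τ₂) ((τ₁ * τ₂) x) = x := by
      intro x
      have hsq12 : (τ₁ * τ₂) ^ 2 = 1 := by
        have hcm : Commute τ₁ τ₂ := hc12
        rw [hcm.mul_pow, h1, h2, one_mul]
      have := congrArg (fun g : Equiv.Perm V => g x) hsq12; simpa [pow_two] using this
    have hne12 : τ₁ * τ₂ ≠ 1 := by
      intro h
      apply hne
      have : τ₁ = τ₂⁻¹ := eq_inv_of_mul_eq_one_left h
      rw [this]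
      -- τ₂⁻¹ = τ₂
      have h2' : τ₂ * τ₂ = 1 := by rw [← pow_two]; exact h2
      exact inv_eq_of_mul_eq_one_left h2'
    have hτ1inf : τ₁ o = o := by
      have : τ₁ = σ ^ 83 := h83.symm
      rw [this]; exact Equiv.Perm.pow_apply_eq_self_of_apply_eq_self hσinf 83
    have hA12 : ∀ x y, A ((τ₁ * τ₂) x) ((τ₁ * τ₂) y) = A x y := fun x y => by
      rw [Equiv.Perm.mul_apply, Equiv.Perm.mul_apply, hA1, hA2]
    exact hbig (τ₁ * τ₂) hinv12 hne12 hA12 (by rw [Equiv.Perm.mul_apply, hτ2inf, hτ1inf]) hτ12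

end centralizer83

end Summit.Ventures.DiscreteObjects.Hadamard
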